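import Summits.ValiantsHypothesis.ValiantsHypothesis.Theorems.KPlusLogSqLawTropicalGradedWalkDomXGlue1

/-!
# Dominance glue (type X), part 2: the block columns `b ≤ u − 2`

GRW-lite `K = 4` graded-walk family (census side of the tropical root law, all `m`):
dominance glue for the EXCURSION states `(w, u, 1)`, `2 ≤ u ≤ w − 1 < m − 1`, of the design typed in
`KPlusLogSqLawTropicalGradedWalkDefs` (Leibniz term: the diagonal term of `(w, u, 0)` with the rows of the columns
`u − 1`, `u` exchanged).  The slack of every rival cell against the row potential `UX` (file `…PotX`) was certified
family by family in `…DomX1` – `…DomX14`; the glue files dispatch an arbitrary rival `(a, b, l)` to its family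
(far rivals are first reduced to the best class of their level by the generic lifts of `…GradedWalkLift`).

Honest framing: this is a census-side (lower-bound) construction — a quadratic family of
distinct optimal slopes for `TropRootLawAt (n+1) 4`.  It says nothing about `TropicalB` inside
its window and nothing about VP ≠ VNP.
-/

set_option linter.dupNamespace false
set_option autoImplicit false

namespace Summit.ValiantsHypothesis.ValiantsHypothesis.Theorems.LacunarySymmetroidMatrixDescartes.TropicalCensus

namespace GradedWalk

open Summit.ValiantsHypothesis.ValiantsHypothesis.Theorems.MatrixDescartes.Negative

variable (n : ℕ)

/-! ### slack, block columns `b ≤ u − 2` -/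

set_option maxHeartbeats 400000 in
/-- slack of the type-X certificate: block column `b ≤ u − 2`. -/
theorem slackX_lt (w u : ℕ) (hu2 : 2 ≤ u) (huw : u < w) (hwn : w ≤ n) (a b : Fin (n + 1)) (l : Fin 4)
    (hp : ee n a b l ≠ 0) (hne : perm n w u 1 b ≠ a ∨ lam n w u 1 b ≠ l) (hbu : (b : ℕ) + 2 ≤ u) :
    1 * (thX n w u * (dd n l : ℤ) - vv n a b l) <
      UX n w u a + ((thX n w u * (dd n (lam n w u 1 b) : ℤ) - vv n (perm n w u 1 b) b (lam n w u 1 b)) - UX n w u (perm n w u 1 b)) := by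
  have hw1 : w ≤ n + 1 := by omega
  have han : (a : ℕ) ≤ n := Nat.lt_succ_iff.mp a.isLt
  have hbn : (b : ℕ) ≤ n := Nat.lt_succ_iff.mp b.isLt
  have hr : ((perm n w u 1 b : Fin (n + 1)) : ℕ) = (b : ℕ) + (n + 1 - w) := sigmaX_blk n huw hw1 b (by omega) (by omega) (by omega)
  rw [lam_X n huw] at hne ⊢
  rw [if_neg (show ¬ w ≤ (b : ℕ) by omega), if_pos (show (b : ℕ) + 1 < u by omega)] at hne ⊢
  have hlowr : (b : ℕ) < ((perm n w u 1 b : Fin (n + 1)) : ℕ) := by rw [hr]; omega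
  have hEr : n + 1 + (b : ℕ) - ((b : ℕ) + (n + 1 - w)) = w := by omega
  have hwne : w ≠ n + 1 := by omega
  have hT2 : thX n w u * (dd n 2 : ℤ) - vv n (perm n w u 1 b) b 2 = thX n w u * d2 n - (v1 n w b + bB n * tau2lt n w b) := by
    rw [dd_cast_two, vv_lower n hlowr, hr, hEr, vblk_two, tau2_of_ne n hwne]
  have hUr : UX n w u ((perm n w u 1 b : Fin (n + 1)) : ℕ) = gG n * thX n w u * ((((b : ℕ) + (n + 1 - w)) : ℕ) : ℤ) + muX n w u b := by
    rw [hr]; unfold UX; rw [show (b : ℕ) + (n + 1 - w) - (n + 1 - w) = b by omega]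
  have hUr' : UX n w u ((perm n w u 1 b : Fin (n + 1)) : ℕ) = gG n * thX n w u * (((n + 1 - w + (b : ℕ)) : ℕ) : ℤ) + SX2 n w u b := by
    rw [hUr, muX_lt n hbu, show (b : ℕ) + (n + 1 - w) = n + 1 - w + (b : ℕ) by omega]
  rcases Nat.lt_or_ge (a : ℕ) (b : ℕ) with hab | hba
  · -- wrap cells above the diagonal: classes 0 / 1
    have hl : l = 0 ∨ l = 1 := by
      rcases (show l = 0 ∨ l = 1 ∨ l = 2 ∨ l = 3 by fin_cases l <;> simp) with rfl | rfl | rfl | rfl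
      · exact Or.inl rfl
      · exact Or.inr rfl
      · exact absurd (ee_upper_ge_two n hab 2 (by decide)) hp
      · exact absurd (ee_upper_ge_two n hab 3 (by decide)) hp
    rcases hl with rfl | rfl
    · rcases Nat.eq_zero_or_pos (a : ℕ) with ha0 | ha0
      · have hc : (((((b : ℕ)) - (0) : ℕ)) : ℤ) = (((b : ℕ)) : ℤ) - (((a : ℕ)) : ℤ) := by
          push_cast [Nat.cast_sub (show 0 ≤ (b : ℕ) by omega), Nat.cast_sub hw1]; omega
        have hX : thX n w u * (dd n 0 : ℤ) - vv n a b 0 = ((0 : ℤ) - 4 * mZ n * gG n ^ 2 * (((((b : ℕ)) - (0)) : ℕ) : ℤ) ^ 2) := by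
          rw [dd_cast_zero, vv_upper_zero n hab, hc]; ring
        have hY : UX n w u a - UX n w u ((perm n w u 1 b : Fin (n + 1)) : ℕ) = ((0 : ℤ) - (gG n * thX n w u * (((n + 1 - w + (b)) : ℕ) : ℤ) + SX2 n w u (b))) := by
          rw [hUr']; unfold UX; rw [ha0, Nat.zero_sub, muX_zero n hu2]; simp
        exact slack_of (X_lt_w0_R0 n w u b (by omega) (by omega) (by omega) (by omega)) hX hT2 hY
      · rcases Nat.lt_or_ge (n + 1 - w) (a : ℕ) with hblk | hpl
        · obtain ⟨jp, hjp⟩ : ∃ jp, (a : ℕ) = (n + 1 - w) + jp := ⟨(a : ℕ) - (n + 1 - w), by omega⟩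
          have hc : (((((b : ℕ)) - ((n + 1 - w) + jp) : ℕ)) : ℤ) = (((b : ℕ)) : ℤ) - (((a : ℕ)) : ℤ) := by
            push_cast [Nat.cast_sub (show (n + 1 - w) + jp ≤ (b : ℕ) by omega), Nat.cast_sub hw1]; omega
          have hX : thX n w u * (dd n 0 : ℤ) - vv n a b 0 = ((0 : ℤ) - 4 * mZ n * gG n ^ 2 * (((((b : ℕ)) - ((n + 1 - w) + jp)) : ℕ) : ℤ) ^ 2) := by
            rw [dd_cast_zero, vv_upper_zero n hab, hc]; ring
          have hY : UX n w u a - UX n w u ((perm n w u 1 b : Fin (n + 1)) : ℕ) = ((gG n * thX n w u * ((((n + 1 - w) + (jp)) : ℕ) : ℤ) + SX2 n w u (jp)) - (gG n * thX n w u * ((((n + 1 - w) + (b)) : ℕ) : ℤ) + SX2 n w u (b))) := by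
            rw [hUr']; unfold UX; rw [show (a : ℕ) - (n + 1 - w) = jp by omega, muX_lt n (by omega), hjp]
          exact slack_of (X_lt_w0_B n w u b jp ((n + 1 - w)) (by omega) (by omega) (by omega) (by omega) (by omega) (by omega)) hX hT2 hY
        · have hc : (((((b : ℕ)) - ((a : ℕ)) : ℕ)) : ℤ) = (((b : ℕ)) : ℤ) - (((a : ℕ)) : ℤ) := by
            push_cast [Nat.cast_sub (show (a : ℕ) ≤ (b : ℕ) by omega), Nat.cast_sub hw1]; omega
          have hX : thX n w u * (dd n 0 : ℤ) - vv n a b 0 = ((0 : ℤ) - 4 * mZ n * gG n ^ 2 * (((((b : ℕ)) - ((a : ℕ))) : ℕ) : ℤ) ^ 2) := by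
            rw [dd_cast_zero, vv_upper_zero n hab, hc]; ring
          have hY : UX n w u a - UX n w u ((perm n w u 1 b : Fin (n + 1)) : ℕ) = (gG n * thX n w u * (((a) : ℕ) : ℤ) - (gG n * thX n w u * (((n + 1 - w + (b)) : ℕ) : ℤ) + SX2 n w u (b))) := by
            rw [hUr']; unfold UX; rw [show (a : ℕ) - (n + 1 - w) = 0 by omega, muX_zero n hu2]; simp
          exact slack_of (X_lt_w0_P n w u b a (by omega) (by omega) (by omega) (by omega) (by omega)) hX hT2 hY
    · rcases Nat.eq_zero_or_pos (a : ℕ) with ha0 | ha0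
      · have hX : thX n w u * (dd n 1 : ℤ) - vv n a b 1 = (thX n w u * d1 n - conn n (((b : ℕ)) - (0)) ((b : ℕ))) := by
          rw [dd_cast_one, vv_upper_one n hab, ha0]
        have hY : UX n w u a - UX n w u ((perm n w u 1 b : Fin (n + 1)) : ℕ) = ((0 : ℤ) - (gG n * thX n w u * (((n + 1 - w + (b)) : ℕ) : ℤ) + SX2 n w u (b))) := by
          rw [hUr']; unfold UX; rw [ha0, Nat.zero_sub, muX_zero n hu2]; simp
        exact slack_of (X_lt_cn_R0 n w u b (by omega) (by omega) (by omega) (by omega)) hX hT2 hY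
      · rcases Nat.lt_or_ge (n + 1 - w) (a : ℕ) with hblk | hpl
        · obtain ⟨jp, hjp⟩ : ∃ jp, (a : ℕ) = (n + 1 - w) + jp := ⟨(a : ℕ) - (n + 1 - w), by omega⟩
          have hX : thX n w u * (dd n 1 : ℤ) - vv n a b 1 = (thX n w u * d1 n - conn n (((b : ℕ)) - ((n + 1 - w) + jp)) ((b : ℕ))) := by
            rw [dd_cast_one, vv_upper_one n hab, hjp]
          have hY : UX n w u a - UX n w u ((perm n w u 1 b : Fin (n + 1)) : ℕ) = ((gG n * thX n w u * ((((n + 1 - w) + (jp)) : ℕ) : ℤ) + SX2 n w u (jp)) - (gG n * thX n w u * ((((n + 1 - w) + (b)) : ℕ) : ℤ) + SX2 n w u (b))) := by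
            rw [hUr']; unfold UX; rw [show (a : ℕ) - (n + 1 - w) = jp by omega, muX_lt n (by omega), hjp]
          exact slack_of (X_lt_cn_B n w u b jp ((n + 1 - w)) (by omega) (by omega) (by omega) (by omega) (by omega) (by omega)) hX hT2 hY
        · have hX : thX n w u * (dd n 1 : ℤ) - vv n a b 1 = (thX n w u * d1 n - conn n (((b : ℕ)) - ((a : ℕ))) ((b : ℕ))) := by
            rw [dd_cast_one, vv_upper_one n hab]
          have hY : UX n w u a - UX n w u ((perm n w u 1 b : Fin (n + 1)) : ℕ) = (gG n * thX n w u * (((a) : ℕ) : ℤ) - (gG n * thX n w u * (((n + 1 - w + (b)) : ℕ) : ℤ) + SX2 n w u (b))) := by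
            rw [hUr']; unfold UX; rw [show (a : ℕ) - (n + 1 - w) = 0 by omega, muX_zero n hu2]; simp
          exact slack_of (X_lt_cn_P n w u b a (by omega) (by omega) (by omega) (by omega) (by omega)) hX hT2 hY
  rcases Nat.lt_or_ge (a : ℕ) ((b : ℕ) + (n + 1 - w)) with halt | hge
  · -- between the diagonal and the intended cell: levels above w (class 1 best), or the diagonal class-0 cell
    obtain ⟨k, hk⟩ : ∃ k, (a : ℕ) + k = (b : ℕ) + (n + 1 - w) := ⟨(b : ℕ) + (n + 1 - w) - (a : ℕ), by omega⟩
    have hk1 : 1 ≤ k := by omega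
    have hkle : k ≤ (b : ℕ) + (n + 1 - w) := by omega
    have hak : (a : ℕ) = (b : ℕ) + (n + 1 - w) - k := by omega
    rcases Nat.eq_or_lt_of_le hba with hab | hab
    · -- diagonal
      have hab' : (a : ℕ) = (b : ℕ) := hab.symm
      by_cases hcl : l = 0
      · subst hcl
        have hX0 : thX n w u * (dd n 0 : ℤ) - vv n a b 0 = thX n w u * 0 - 0 := by rw [dd_cast_zero, vv_diag_zero n hab']
        have hrow : UX n w u a = UX n w u (b : ℕ) := by rw [hab']
        rcases Nat.lt_or_ge (n + 1 - w) (b : ℕ) with hblk | hpl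
        · obtain ⟨jp, hjp⟩ : ∃ jp, (b : ℕ) = (n + 1 - w) + jp := ⟨(b : ℕ) - (n + 1 - w), by omega⟩
          have hY : UX n w u a - UX n w u ((perm n w u 1 b : Fin (n + 1)) : ℕ) = ((gG n * thX n w u * ((((n + 1 - w) + (jp)) : ℕ) : ℤ) + SX2 n w u (jp)) - (gG n * thX n w u * ((((n + 1 - w) + ((n + 1 - w) + jp)) : ℕ) : ℤ) + SX2 n w u ((n + 1 - w) + jp))) := by
            rw [hrow, hUr', hjp]; unfold UX; rw [show n + 1 - w + jp - (n + 1 - w) = jp by omega, muX_lt n (by omega)]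
          have hF := X_lt_dg0_B n w u jp ((n + 1 - w)) (by omega) (by omega) (by omega) (by omega) (by omega)
          rw [hjp] at hT2
          exact slack_of hF hX0 hT2 hY
        · by_cases hb0 : (b : ℕ) = 0
          · have hY : UX n w u a - UX n w u ((perm n w u 1 b : Fin (n + 1)) : ℕ) = ((gG n * thX n w u * (((0) : ℕ) : ℤ) + SX2 n w u (0)) - (gG n * thX n w u * (((n + 1 - w + (0)) : ℕ) : ℤ) + SX2 n w u (0))) := by
              rw [hrow, hUr', hb0]; unfold UX; rw [Nat.zero_sub, muX_lt n (by omega)]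
            rw [hb0] at hT2
            exact slack_of (X_lt_dg0_P0 n w u (by omega) (by omega) (by omega)) hX0 hT2 hY
          · have hY : UX n w u a - UX n w u ((perm n w u 1 b : Fin (n + 1)) : ℕ) = (gG n * thX n w u * (((b) : ℕ) : ℤ) - (gG n * thX n w u * (((n + 1 - w + (b)) : ℕ) : ℤ) + SX2 n w u (b))) := by
              rw [hrow, hUr']; unfold UX; rw [show (b : ℕ) - (n + 1 - w) = 0 by omega, muX_zero n hu2]; simp
            exact slack_of (X_lt_dg0_P n w u b (by omega) (by omega) (by omega) (by omega)) hX0 hT2 hY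
      · have hθ : thX n w u ≤ LL n * ((n : ℤ) + 1) := thX_le_top n huw hwn
        have hX1 : thX n w u * (dd n 1 : ℤ) - vv n a b 1 = thX n w u * d1 n - v1 n (n + 1) b := by
          rw [dd_cast_one, vv_diag n hab' 1 (by decide), vblk_one]
        have hXl : thX n w u * (dd n l : ℤ) - vv n a b l + 1 ≤ thX n w u * d1 n - v1 n (n + 1) b + 1 ∨ l = 1 := by
          rcases (show l = 0 ∨ l = 1 ∨ l = 2 ∨ l = 3 by fin_cases l <;> simp) with rfl | rfl | rfl | rfl
          · exact absurd rfl hcl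
          · exact Or.inr rfl
          · left; rw [dd_cast_two, vv_diag n hab' 2 (by decide), vblk_two]
            linarith [lift_fut2_top n (θ := thX n w u) (b : ℕ) hθ]
          · left; rw [dd_cast_three, vv_diag n hab' 3 (by decide), vblk_three]
            linarith [lift_fut3_top n (θ := thX n w u) (b : ℕ) hθ]
        have hXl : thX n w u * (dd n l : ℤ) - vv n a b l ≤ thX n w u * d1 n - v1 n (n + 1) b := by
          rcases hXl with h | rfl
          · linarith
          · exact le_of_eq hX1
        clear hX1
        by_cases hb0 : (b : ℕ) = 0
        · have hY : UX n w u a - UX n w u ((perm n w u 1 b : Fin (n + 1)) : ℕ) = (gG n * thX n w u * (((n + 1 - w - k) : ℕ) : ℤ) - gG n * thX n w u * (((n + 1 - w) : ℕ) : ℤ)) := by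
            rw [hUr, hb0, muX_zero n hu2, Nat.zero_add]; unfold UX; rw [show (a : ℕ) - (n + 1 - w) = 0 by omega, muX_zero n hu2, show (a : ℕ) = n + 1 - w - k by omega]; ring
          have hF := X_lt_up_PA0_m n w u k (by omega) (by omega) (by omega) (by omega)
          rw [hb0] at hXl hT2
          exact slack_le hF hXl hT2 hY
        · rcases Nat.lt_or_ge (b : ℕ) k with hkb | hkb
          · have hY : UX n w u a - UX n w u ((perm n w u 1 b : Fin (n + 1)) : ℕ) = (gG n * thX n w u * (((n + 1 - w + b - k) : ℕ) : ℤ) - (gG n * thX n w u * (((n + 1 - w + (b)) : ℕ) : ℤ) + SX2 n w u (b))) := by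
              rw [hUr']; unfold UX; rw [show (a : ℕ) - (n + 1 - w) = 0 by omega, muX_zero n hu2, show (a : ℕ) = n + 1 - w + (b : ℕ) - k by omega]; ring
            exact slack_le (X_lt_up_PA_m n w u b k (by omega) (by omega) (by omega) (by omega) (by omega)) hXl hT2 hY
          · have hY : UX n w u a - UX n w u ((perm n w u 1 b : Fin (n + 1)) : ℕ) = ((-(gG n * thX n w u * ((k : ℕ) : ℤ))) + (SX2 n w u (b - k) - SX2 n w u (b))) := by
              rw [hUr]; rw [muX_lt n hbu]; unfold UX; rw [show (a : ℕ) - (n + 1 - w) = (b : ℕ) - k by omega, muX_lt n (by omega), hak]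
              push_cast [Nat.cast_sub hkle, Nat.cast_sub hw1]; ring
            exact slack_le (X_lt_up_A_m n w u b k (by omega) (by omega) (by omega) (by omega) (by omega)) hXl hT2 hY
    · -- strictly between: level w + k
      have hEa : n + 1 + (b : ℕ) - (a : ℕ) = w + k := by omega
      have hne1 : w + k ≠ n + 1 := by omega
      have hθ : thX n w u ≤ LL n * ((w + k : ℕ) : ℤ) := thX_le_LE n huw hwn (by omega)
      have hcl : l ≠ 0 := fun h0 => by subst h0; exact hp (ee_lower_zero n hab)
      have hX1 : thX n w u * (dd n 1 : ℤ) - vv n a b 1 = thX n w u * d1 n - v1 n (w + k) b := by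
        rw [dd_cast_one, vv_lower n hab, hEa, vblk_one]
      have hXl : thX n w u * (dd n l : ℤ) - vv n a b l + 1 ≤ thX n w u * d1 n - v1 n (w + k) b + 1 ∨ l = 1 := by
        rcases (show l = 0 ∨ l = 1 ∨ l = 2 ∨ l = 3 by fin_cases l <;> simp) with rfl | rfl | rfl | rfl
        · exact absurd rfl hcl
        · exact Or.inr rfl
        · left; rw [dd_cast_two, vv_lower n hab, hEa, vblk_two, tau2_of_ne n hne1]
          linarith [lift_fut2 n (θ := thX n w u) (E := w + k) (b : ℕ) hθ]
        · left; rw [dd_cast_three, vv_lower n hab, hEa, vblk_three, tau2_of_ne n hne1, tau3_of_ne n hne1]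
          linarith [lift_fut3 n (θ := thX n w u) (E := w + k) (b : ℕ) hθ]
      have hXl : thX n w u * (dd n l : ℤ) - vv n a b l ≤ thX n w u * d1 n - v1 n (w + k) b := by
        rcases hXl with h | rfl
        · linarith
        · exact le_of_eq hX1
      clear hX1
      by_cases hb0 : (b : ℕ) = 0
      · have hY : UX n w u a - UX n w u ((perm n w u 1 b : Fin (n + 1)) : ℕ) = (gG n * thX n w u * (((n + 1 - w - k) : ℕ) : ℤ) - gG n * thX n w u * (((n + 1 - w) : ℕ) : ℤ)) := by
          rw [hUr, hb0, muX_zero n hu2, Nat.zero_add]; unfold UX; rw [show (a : ℕ) - (n + 1 - w) = 0 by omega, muX_zero n hu2, show (a : ℕ) = n + 1 - w - k by omega]; ring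
        have hF := X_lt_up_PA0_lt n w u k (by omega) (by omega) (by omega) (by omega)
        rw [hb0] at hXl hT2
        exact slack_le hF hXl hT2 hY
      · rcases Nat.lt_or_ge (b : ℕ) k with hkb | hkb
        · have hY : UX n w u a - UX n w u ((perm n w u 1 b : Fin (n + 1)) : ℕ) = (gG n * thX n w u * (((n + 1 - w + b - k) : ℕ) : ℤ) - (gG n * thX n w u * (((n + 1 - w + (b)) : ℕ) : ℤ) + SX2 n w u (b))) := by
            rw [hUr']; unfold UX; rw [show (a : ℕ) - (n + 1 - w) = 0 by omega, muX_zero n hu2, show (a : ℕ) = n + 1 - w + (b : ℕ) - k by omega]; ring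
          exact slack_le (X_lt_up_PA_lt n w u b k (by omega) (by omega) (by omega) (by omega) (by omega)) hXl hT2 hY
        · have hY : UX n w u a - UX n w u ((perm n w u 1 b : Fin (n + 1)) : ℕ) = ((-(gG n * thX n w u * ((k : ℕ) : ℤ))) + (SX2 n w u (b - k) - SX2 n w u (b))) := by
            rw [hUr]; rw [muX_lt n hbu]; unfold UX; rw [show (a : ℕ) - (n + 1 - w) = (b : ℕ) - k by omega, muX_lt n (by omega), hak]
            push_cast [Nat.cast_sub hkle, Nat.cast_sub hw1]; ring
          exact slack_le (X_lt_up_A_lt n w u b k (by omega) (by omega) (by omega) (by omega) (by omega)) hXl hT2 hY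
  rcases Nat.eq_or_lt_of_le hge with haeq | hagt
  · -- class rivals at the intended cell
    have hlow : (b : ℕ) < (a : ℕ) := by omega
    have hrot : perm n w u 1 b = a := Fin.ext (by rw [hr, haeq])
    have hY : UX n w u a - UX n w u ((perm n w u 1 b : Fin (n + 1)) : ℕ) = 0 := by rw [hrot]; ring
    have hEa : n + 1 + (b : ℕ) - (a : ℕ) = w := by omega
    rcases (show l = 0 ∨ l = 1 ∨ l = 2 ∨ l = 3 by fin_cases l <;> simp) with rfl | rfl | rfl | rfl
    · exact absurd (ee_lower_zero n hlow) hp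
    · have hX : thX n w u * (dd n 1 : ℤ) - vv n a b 1 = thX n w u * d1 n - v1 n w b := by
        rw [dd_cast_one, vv_lower n hlow, hEa, vblk_one]
      exact slack_of0 (X_lt_cls_l1 n w u b (by omega) (by omega) (by omega)) hX hT2 hY
    · exact absurd rfl (hne.resolve_left (fun h => h hrot))
    · have hX : thX n w u * (dd n 3 : ℤ) - vv n a b 3 = thX n w u * d3 n - ((v1 n w b + bB n * tau2lt n w b) + tau3lt n w b) := by
        rw [dd_cast_three, vv_lower n hlow, hEa, vblk_three, tau2_of_ne n hwne, tau3_of_ne n hwne]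
      exact slack_of0 (X_lt_cls_l3 n w u b (by omega) (by omega) (by omega)) hX hT2 hY
  · -- below the intended cell: level w - k, class 3 best
    have hlow : (b : ℕ) < (a : ℕ) := by omega
    obtain ⟨k, hk⟩ : ∃ k, (a : ℕ) = (b : ℕ) + (n + 1 - w) + k := ⟨(a : ℕ) - ((b : ℕ) + (n + 1 - w)), by omega⟩
    have hk1 : 1 ≤ k := by omega
    have hEa : n + 1 + (b : ℕ) - (a : ℕ) = w - k := by omega
    have hne3 : w - k ≠ n + 1 := by omega
    have hθ : LL n * ((w - k : ℕ) + 1) ≤ thX n w u := LE_le_thX n u (by omega)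
    have hX3 : thX n w u * (dd n 3 : ℤ) - vv n a b 3 = thX n w u * d3 n - ((v1 n (w - k) b + bB n * tau2lt n (w - k) b) + tau3lt n (w - k) b) := by
      rw [dd_cast_three, vv_lower n hlow, hEa, vblk_three, tau2_of_ne n hne3, tau3_of_ne n hne3]
    have hlift : thX n w u * (dd n l : ℤ) - vv n a b l + (if l = 3 then 0 else 1) ≤ thX n w u * d3 n - ((v1 n (w - k) b + bB n * tau2lt n (w - k) b) + tau3lt n (w - k) b) := by
      rcases (show l = 0 ∨ l = 1 ∨ l = 2 ∨ l = 3 by fin_cases l <;> simp) with rfl | rfl | rfl | rfl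
      · exact absurd (ee_lower_zero n hlow) hp
      · rw [dd_cast_one, vv_lower n hlow, hEa, vblk_one]
        simp only [show ((1 : Fin 4) = 3) = False by decide, ite_false]
        linarith [lift_past1 n (θ := thX n w u) (c := (b : ℕ)) hbn (by omega) hθ]
      · rw [dd_cast_two, vv_lower n hlow, hEa, vblk_two, tau2_of_ne n hne3]
        simp only [show ((2 : Fin 4) = 3) = False by decide, ite_false]
        linarith [lift_past2 n (θ := thX n w u) (c := (b : ℕ)) hbn (by omega) hθ]
      · rw [hX3]; simp
    have hj : (a : ℕ) - (n + 1 - w) = (b : ℕ) + k := by omega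
    rcases Nat.lt_or_ge ((b : ℕ) + k + 1) u with hj1 | hj1
    · have hY : UX n w u a - UX n w u ((perm n w u 1 b : Fin (n + 1)) : ℕ) = (gG n * thX n w u * ((k : ℕ) : ℤ) + (SX2 n w u (b + k) - SX2 n w u (b))) := by
        rw [hUr, muX_lt n hbu]; unfold UX; rw [hj, muX_lt n (by omega), hk]; push_cast [Nat.cast_sub hw1]; ring
      have hF := X_lt_down_A n w u b k (by omega) (by omega) (by omega) (by omega)
      exact slack_of (lift_combine hlift hF) rfl hT2 hY
    · rcases Nat.lt_or_ge ((b : ℕ) + k) (u + 2) with hj2 | hj2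
      · -- j in {u-1, u, u+1}
        rcases Nat.lt_trichotomy ((b : ℕ) + k) u with hj3 | hj3 | hj3
        · -- j = u - 1
          have hu : u = (b : ℕ) + k + 1 := by omega
          subst hu
          have hY : UX n w ((b : ℕ) + k + 1) a - UX n w ((b : ℕ) + k + 1) ((perm n w ((b : ℕ) + k + 1) 1 b : Fin (n + 1)) : ℕ) = (gG n * thX n w (b + k + 1) * ((k : ℕ) : ℤ) + (SXR1 n w (b + k + 1) - SX2 n w (b + k + 1) (b))) := by
            rw [hUr, muX_lt n hbu]; unfold UX; rw [hj, muX_R1 n rfl, hk]; push_cast [Nat.cast_sub hw1]; ring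
          have hF := X_lt_down_R1 n w b k (by omega) (by omega) (by omega)
          exact slack_of (lift_combine hlift hF) rfl hT2 hY
        · -- j = u
          have hu : u = (b : ℕ) + k := by omega
          subst hu
          have hY : UX n w ((b : ℕ) + k) a - UX n w ((b : ℕ) + k) ((perm n w ((b : ℕ) + k) 1 b : Fin (n + 1)) : ℕ) = (gG n * thX n w (b + k) * ((k : ℕ) : ℤ) + (SXR2 n w (b + k) - SX2 n w (b + k) (b))) := by
            rw [hUr, muX_lt n hbu]; unfold UX; rw [hj, muX_R2, hk]; push_cast [Nat.cast_sub hw1]; ring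
          have hF := X_lt_down_R2 n w b k (by omega) (by omega) (by omega)
          exact slack_of (lift_combine hlift hF) rfl hT2 hY
        · -- j = u + 1
          have hu : u = (b : ℕ) + k - 1 := by omega
          subst hu
          have hY : UX n w ((b : ℕ) + k - 1) a - UX n w ((b : ℕ) + k - 1) ((perm n w ((b : ℕ) + k - 1) 1 b : Fin (n + 1)) : ℕ) = (gG n * thX n w (b + k - 1) * ((k : ℕ) : ℤ) + (SXP n w (b + k - 1) - SX2 n w (b + k - 1) (b))) := by
            rw [hUr, muX_lt n hbu]; unfold UX; rw [hj, muX_P' n (by omega), hk]; push_cast [Nat.cast_sub hw1]; ring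
          have hF := X_lt_down_P n w b k (by omega) (by omega) (by omega)
          exact slack_of (lift_combine hlift hF) rfl hT2 hY
      · have hY : UX n w u a - UX n w u ((perm n w u 1 b : Fin (n + 1)) : ℕ) = (gG n * thX n w u * ((k : ℕ) : ℤ) + (SXL n w u (b + k) - SX2 n w u (b))) := by
          rw [hUr, muX_lt n hbu]; unfold UX; rw [hj, muX_ge n hj2, hk]; push_cast [Nat.cast_sub hw1]; ring
        have hF := X_lt_down_ge n w u b k (by omega) (by omega) (by omega) (by omega)
        exact slack_of (lift_combine hlift hF) rfl hT2 hY

end GradedWalk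

end Summit.ValiantsHypothesis.ValiantsHypothesis.Theorems.LacunarySymmetroidMatrixDescartes.TropicalCensus
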